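import Summits.QuantumFields.YangMills.Theorems.BalabanUVNodesPortS1SmallLetter
import Literature.MathematicalPhysics.QuantumFieldTheory.Balaban1983to89.B7Prop6Flat

/-!
# NODE O port PT-A — THE JACOBIAN FACTORS OF (1.4)'s δ-FUNCTION ELIMINATION ARE LOCAL AND GAUGE COVARIANT: at backgrounds in the (0.4) guard, `(LQ̃(V^{(k)}) B′)(c)`
# depends on `V^{(k)}` and `B′` only through the WINDOW of `c` (the fine bonds of `B(c₋) ∪ B(c₊)`), so the `c`-block `A₁(c)` and its Jacobian factor `log|det A₁(c)|` are LOCAL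
# functionals of the background ([I] p.268 «C is the operator determined by the configuration V^{(k)}», (1.7)); and `Q̃`, `LQ̃` are GAUGE COVARIANT ((2.16)):
# `Q̃(V^u, B′)(c) = u(c₋)·Q̃(V, B̃′)(c)·u(c₋)*`, `LQ̃(V^u) = Ad_{u(c₋)} ∘ LQ̃(V) ∘ R` with the bondwise coordinate rotation `R`

Cell `ym-nodeO-ideate`, porter seat `ymgap-nodeO-port-PTA-1` (gen 5); `--supports stmt-QuantumFields-27930` (helper; first structural rows — (1.7) locality and (2.16) covariance at REAL
points — of the δ-Jacobian bracket `Σ_c log|det A₁(c)|` of `phiLZ_eq_logDet_sum` ✓p809947, the P0-FREE part of the LZ half).  [I] = [Balaban1987RG1], [B7] = [Balaban1985Averaging].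
CONSUMED BY NAME, nothing modified: ✓p811778 (`recordLQt_apply_eq_fderiv_avgM`, `hasFDerivAt_recordQt_of_small`, `coe_pert`, `recordQt_apply_eq_mlog`, `sum_su2Coord_smul_su2Gen`); DEF-1's names;
dag-n07's `N07AveragingLocalSmooth.contDiffAt_avgM_apply`, `N07AveragingLocalMatrixModel.avgM_congr_of_window`; the tree's `BlockAveraging.avgFun_local ∕ avgFun_covariant ∕ small_gaugeAct_iff`,
`B7Prop6Flat.mlog_conj` (conjugation covariance of the series logarithm with NO hypothesis), Mathlib's `NormedSpace.exp_units_conj'`.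
* §1 `fderiv_apply_eq_of_lines_eq` (a directional derivative is the velocity of the restricted curve).
* §2 ★★ `recordLQt_apply_eq_of_agree_window` (locality of `LQ̃` in background AND fluctuation), ★★ `b0Block_eq_of_agree_window`, ★ `log_abs_det_b0Block_eq_of_agree_window`.
* §3 `pert_gaugeAct` (the chart is covariant with rotated coordinates), ★ `recordQt_gaugeAct` (all fluctuations, no smallness), `exists_rotCLM` (the rotation as a continuous linear map),
  ★★ `recordLQt_gaugeAct` (small backgrounds; chain rule at `0`).

HONEST FRAMING.  Kernel calculus ∕ algebra over the tree's own theorems; NOTHING of Bałaban's estimates asserted, ported or discharged; these are the (1.7)∕(2.16) rows of the Jacobian factors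
at `SU(2)` points only — their holomorphic extension to the complex pairs of (1.11)–(1.16) (row (a)) and the (1.18) bound are NOT here; `stub_LZ` BLOCKED-ON P0 (α)+(β), `stub_FE` XXL; 27930
OPEN · no claim; K0⁷∕K-Ax OPEN; NODE O 0∕1; COUNT 8∕28 · K 1∕4 UNMOVED; finite `𝕋⁴_{L^K}` at fixed ε — NOT continuum ∕ OS ∕ Clay; **the Yang–Mills mass gap is NOT proved by any of this.**
No `sorry`, no `def`, no `instance`, no `notation`; standard axioms.
-/

noncomputable section

open scoped BigOperators Matrix.Norms.L2Operator Topology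

namespace Summit.QuantumFields.YangMills.Theorems.BalabanUVNodesPortS1

open Summit.QuantumFields.YangMills.Theorems.K0RecordFormatNames
open Summit.QuantumFields.YangMills.BalabanUVNodes
open Literature.MathematicalPhysics.QuantumFieldTheory.Balaban1983to89
open Literature.MathematicalPhysics.QuantumFieldTheory.Balaban1983to89.Node00
open Literature.MathematicalPhysics.QuantumFieldTheory.Balaban1983to89.T4Continuum (T4Family)
open Literature.MathematicalPhysics.QuantumFieldTheory.Balaban1983to89.BlockAveraging (avgFun loopHol Small Idx avgFun_local avgFun_covariant small_gaugeAct_iff)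
open Literature.MathematicalPhysics.QuantumFieldTheory.Balaban1983to89.BlockAveragingHaarAC (centralBond)
open Literature.MathematicalPhysics.QuantumFieldTheory.Balaban1983to89.ExpMeanLog (expMeanLogSU)
open Literature.MathematicalPhysics.QuantumFieldTheory.Balaban1983to89.T4AdjointCovarianceUnitary (lieSU mem_lieSU_iff conj_mem_lieSU)
open NormedSpace (exp)
open _root_.Matrix _root_.Filter

variable (F : T4Family)

/-! ## §1  A derivative in a direction is determined by the function along the line -/

/-- If `f(W + t·v) = f(W′ + t·v′)` for all real `t` and `f` is differentiable at `W` and `W′`, then `Df(W)v = Df(W′)v′` (both are the velocity of one curve). [folklore] -/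
theorem fderiv_apply_eq_of_lines_eq {E G : Type*} [NormedAddCommGroup E] [NormedSpace ℝ E] [NormedAddCommGroup G] [NormedSpace ℝ G]
    {f : E → G} {W W' v v' : E} (hf : DifferentiableAt ℝ f W) (hf' : DifferentiableAt ℝ f W')
    (h : ∀ t : ℝ, f (W + t • v) = f (W' + t • v')) : fderiv ℝ f W v = fderiv ℝ f W' v' := by
  have key : ∀ (W v : E), DifferentiableAt ℝ f W → HasDerivAt (fun t : ℝ => f (W + t • v)) (fderiv ℝ f W v) 0 := by
    intro W v hW
    have hl : HasDerivAt (fun t : ℝ => W + t • v) v 0 := by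
      simpa using ((hasDerivAt_id (0 : ℝ)).smul_const v).const_add W
    have hF : HasFDerivAt f (fderiv ℝ f W) ((fun t : ℝ => W + t • v) 0) := by
      have e : (fun t : ℝ => W + t • v) 0 = W := by simp
      rw [e]; exact hW.hasFDerivAt
    exact hF.comp_hasDerivAt (0 : ℝ) hl
  have h1 := key W v hf
  have h2 := key W' v' hf'
  have hfun : (fun t : ℝ => f (W + t • v)) = fun t : ℝ => f (W' + t • v') := funext h
  rw [hfun] at h1
  exact h1.unique h2

/-! ## §2  ★★ Locality of `LQ̃(V^{(k)})` in the background and in the fluctuation: the window of `c` -/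

/-- `fluctMat` at a bond reads the three coordinates at that bond. [cite: Balaban1987RG1, (2.4) p.266 (bookkeeping)] -/
theorem fluctMat_congr (k K : ℕ) {x x' : FluctIdx F k K → ℝ} {b : PBond (F.P K) k} (h : ∀ a, x (b, a) = x' (b, a)) :
    fluctMat F k K x b = fluctMat F k K x' b := by
  simp only [fluctMat, h]

/-- ★★ **LOCALITY OF `LQ̃(V^{(k)})` (p.267–268: `L`, `h`, `C` are «determined by the configuration V^{(k)}» locally)**: at two backgrounds in the (0.4) guard that AGREE on the window of `c`
(the fine bonds issuing from the blocks `B(c₋)`, `B(c₊)`), and two fluctuations that agree there, `(LQ̃(Vk) x)(c) = (LQ̃(Vk′) x′)(c)` — through `recordLQt_apply_eq_fderiv_avgM`, the window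
locality of the matrix model (`avgM_congr_of_window`) and of `Ū(c)` (`avgFun_local`). [cite: Balaban1987RG1, p.267–268; Balaban1985Averaging, (15) p.19, Prop. 4 p.38 (locality)] -/
theorem recordLQt_apply_eq_of_agree_window (k K : ℕ) (hk : k + 1 ≤ (F.P K).m + (F.P K).K) (Vk Vk' : GaugeField (F.P K) k (SU 2))
    (hs : ∀ c : PBond (F.P K) (k + 1), Small expMeanLogSU Vk c) (hs' : ∀ c : PBond (F.P K) (k + 1), Small expMeanLogSU Vk' c)
    (c : PBond (F.P K) (k + 1)) (hV : ∀ b : PBond (F.P K) k, (blockOf b.src = c.src ∨ blockOf b.src = c.tgt) → Vk b = Vk' b)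
    {x x' : FluctIdx F k K → ℝ} (hx : ∀ b : PBond (F.P K) k, (blockOf b.src = c.src ∨ blockOf b.src = c.tgt) → ∀ a, x (b, a) = x' (b, a)) :
    recordLQt F k K Vk x c = recordLQt F k K Vk' x' c := by
  rw [recordLQt_apply_eq_fderiv_avgM F k K hk Vk hs x c, recordLQt_apply_eq_fderiv_avgM F k K hk Vk' hs' x' c,
    avgFun_local expMeanLogSU hk Vk Vk' c hV]
  congr 1
  refine fderiv_apply_eq_of_lines_eq
    ((N07AveragingLocalSmooth.contDiffAt_avgM_apply (n := ⊤) c fun i => norm_loopM_coeField_sub_one_lt_one Vk c (hs c) i).differentiableAt (by simp))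
    ((N07AveragingLocalSmooth.contDiffAt_avgM_apply (n := ⊤) c fun i => norm_loopM_coeField_sub_one_lt_one Vk' c (hs' c) i).differentiableAt (by simp))
    fun t => ?_
  refine N07AveragingLocalMatrixModel.avgM_congr_of_window hk c fun b hb => ?_
  simp only [Pi.add_apply, Pi.smul_apply, coeField_apply, hV b hb, fluctMat_congr F k K (hx b hb)]

/-- ★★ **THE `c`-BLOCK OF `A₁` IS A LOCAL FUNCTION OF THE BACKGROUND**: two backgrounds in the guard agreeing on the window of `c` have the same `3 × 3` block `A₁(c)` (the central bond `b₀(c)`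
lies in the window). [cite: Balaban1987RG1, p.267 («h(c)»), p.268 («C is the operator determined by the configuration V^{(k)}»)] -/
theorem b0Block_eq_of_agree_window (k K : ℕ) (hk : k + 1 ≤ (F.P K).m + (F.P K).K) (Vk Vk' : GaugeField (F.P K) k (SU 2))
    (hs : ∀ c : PBond (F.P K) (k + 1), Small expMeanLogSU Vk c) (hs' : ∀ c : PBond (F.P K) (k + 1), Small expMeanLogSU Vk' c)
    (c : PBond (F.P K) (k + 1)) (hV : ∀ b : PBond (F.P K) k, (blockOf b.src = c.src ∨ blockOf b.src = c.tgt) → Vk b = Vk' b) :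
    (Matrix.of fun j j' : Fin 3 => recordLQtB0 F k K Vk (c, j) (c, j')) = Matrix.of fun j j' : Fin 3 => recordLQtB0 F k K Vk' (c, j) (c, j') := by
  ext j j'
  simp only [Matrix.of_apply, recordLQtB0, recordLQtMat]
  rw [recordLQt_apply_eq_of_agree_window F k K hk Vk Vk' hs hs' c hV (x := Pi.single (recordB0 F k K c, j') (1 : ℝ)) (x' := Pi.single (recordB0 F k K c, j') (1 : ℝ))
    fun b _ a => rfl]

/-- ★ **… hence the Jacobian factor `log|det A₁(c)|` of the δ-function elimination is a LOCAL functional of `V^{(k)}`** (the (1.7)-locality of the `c`-term of the δ-Jacobian bracket of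
`phiLZ_eq_logDet_sum`, at small backgrounds). [cite: Balaban1987RG1, (1.7) p.261, p.268] -/
theorem log_abs_det_b0Block_eq_of_agree_window (k K : ℕ) (hk : k + 1 ≤ (F.P K).m + (F.P K).K) (Vk Vk' : GaugeField (F.P K) k (SU 2))
    (hs : ∀ c : PBond (F.P K) (k + 1), Small expMeanLogSU Vk c) (hs' : ∀ c : PBond (F.P K) (k + 1), Small expMeanLogSU Vk' c)
    (c : PBond (F.P K) (k + 1)) (hV : ∀ b : PBond (F.P K) k, (blockOf b.src = c.src ∨ blockOf b.src = c.tgt) → Vk b = Vk' b) :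
    Real.log |(Matrix.of fun j j' : Fin 3 => recordLQtB0 F k K Vk (c, j) (c, j')).det| =
      Real.log |(Matrix.of fun j j' : Fin 3 => recordLQtB0 F k K Vk' (c, j) (c, j')).det| := by
  rw [b0Block_eq_of_agree_window F k K hk Vk Vk' hs hs' c hV]

/-! ## §3  Gauge covariance of `Q̃` and `LQ̃` (p.269 (2.16)) -/

/-- An `SU(2)` matrix as a unit of `M₂(ℂ)` with inverse its adjoint. [folklore] -/
theorem coe_mul_star_self_SU (g : SU 2) : (g : MatA 2) * star (g : MatA 2) = 1 :=
  (Matrix.mem_unitaryGroup_iff).mp (Matrix.mem_specialUnitaryGroup_iff.mp g.2).1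

/-- The adjoint on the other side. [folklore] -/
theorem star_mul_coe_self_SU (g : SU 2) : star (g : MatA 2) * (g : MatA 2) = 1 :=
  (Matrix.mem_unitaryGroup_iff').mp (Matrix.mem_specialUnitaryGroup_iff.mp g.2).1

/-- **The chart is gauge covariant with rotated coordinates**: if `B̃′(b) = u(b₋)* B′(b) u(b₋)` bondwise, then `V′(B′)·V^{(k),u} = (V′(B̃′)·V^{(k)})^u`
(`exp(u* X u) = u* exp(X) u`). [cite: Balaban1987RG1, (2.16) p.269, (2.4) p.266] -/
theorem pert_gaugeAct (k K : ℕ) (u : GaugeTransf (F.P K) k (SU 2)) (Vk : GaugeField (F.P K) k (SU 2)) (x x' : FluctIdx F k K → ℝ)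
    (hx : ∀ b : PBond (F.P K) k, fluctMat F k K x' b = star ((u b.src : SU 2) : MatA 2) * fluctMat F k K x b * ((u b.src : SU 2) : MatA 2)) :
    pert F k K (GaugeField.gaugeAct u Vk) x = GaugeField.gaugeAct u (pert F k K Vk x') := by
  funext b
  apply Subtype.ext
  set us : MatA 2 := ((u b.src : SU 2) : MatA 2) with hus
  let w : (MatA 2)ˣ :=
    { val := us, inv := star us, val_inv := by rw [hus]; exact coe_mul_star_self_SU (u b.src), inv_val := by rw [hus]; exact star_mul_coe_self_SU (u b.src) }
  letI : NormedAlgebra ℚ (MatA 2) := NormedAlgebra.restrictScalars ℚ ℂ (MatA 2)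
  have hexp : exp (fluctMat F k K x' b) = star us * exp (fluctMat F k K x b) * us := by
    rw [hx b, ← hus]
    exact NormedSpace.exp_units_conj' w (fluctMat F k K x b)
  show ((pert F k K (GaugeField.gaugeAct u Vk) x b : SU 2) : MatA 2) = ((GaugeField.gaugeAct u (pert F k K Vk x') b : SU 2) : MatA 2)
  rw [coe_pert, GaugeField.gaugeAct, GaugeField.gaugeAct, Submonoid.coe_mul, Submonoid.coe_mul, Submonoid.coe_mul, Submonoid.coe_mul, coe_pert, hexp, ← hus]
  have hinv : (((u b.tgt)⁻¹ : SU 2) : MatA 2) = star ((u b.tgt : SU 2) : MatA 2) := rfl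
  rw [hinv]
  calc exp (fluctMat F k K x b) * (us * ((Vk b : SU 2) : MatA 2) * star ((u b.tgt : SU 2) : MatA 2))
      = (us * star us) * exp (fluctMat F k K x b) * (us * ((Vk b : SU 2) : MatA 2) * star ((u b.tgt : SU 2) : MatA 2)) := by
        rw [hus, coe_mul_star_self_SU, one_mul]
    _ = us * (star us * exp (fluctMat F k K x b) * us * ((Vk b : SU 2) : MatA 2)) * star ((u b.tgt : SU 2) : MatA 2) := by noncomm_ring

/-- ★ **`Q̃` IS GAUGE COVARIANT** (for every fluctuation, no smallness needed): `Q̃(V^{(k),u}, B′)(c) = u(c₋)·Q̃(V^{(k)}, B̃′)(c)·u(c₋)*` with `u(c₋) := u(emb c₋)` and the rotated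
coordinates `B̃′` — the (0.4) average is covariant (`avgFun_covariant`) and the series logarithm is conjugation covariant with NO hypothesis (`B7Prop6Flat.mlog_conj`).
[cite: Balaban1987RG1, (2.16) p.269, (0.6) p.253; Balaban1985Averaging, (21)–(22) p.21, p.24] -/
theorem recordQt_gaugeAct (k K : ℕ) (hk : k + 1 ≤ (F.P K).m + (F.P K).K) (u : GaugeTransf (F.P K) k (SU 2)) (Vk : GaugeField (F.P K) k (SU 2))
    (x x' : FluctIdx F k K → ℝ)
    (hx : ∀ b : PBond (F.P K) k, fluctMat F k K x' b = star ((u b.src : SU 2) : MatA 2) * fluctMat F k K x b * ((u b.src : SU 2) : MatA 2))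
    (c : PBond (F.P K) (k + 1)) :
    recordQt F k K (GaugeField.gaugeAct u Vk) x c =
      ((u (emb c.src) : SU 2) : MatA 2) * recordQt F k K Vk x' c * star ((u (emb c.src) : SU 2) : MatA 2) := by
  set uc : MatA 2 := ((u (emb c.src) : SU 2) : MatA 2) with huc
  let w : (MatA 2)ˣ :=
    { val := uc, inv := star uc, val_inv := by rw [huc]; exact coe_mul_star_self_SU _, inv_val := by rw [huc]; exact star_mul_coe_self_SU _ }
  rw [recordQt_apply_eq_mlog, recordQt_apply_eq_mlog, pert_gaugeAct F k K u Vk x x' hx, avgFun_covariant expMeanLogSU hk u (pert F k K Vk x'),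
    avgFun_covariant expMeanLogSU hk u Vk]
  simp only [GaugeField.gaugeAct, Submonoid.coe_mul]
  have hinv : ∀ g : SU 2, (((g)⁻¹ : SU 2) : MatA 2) = star ((g : SU 2) : MatA 2) := fun g => rfl
  rw [hinv, ← huc]
  set A : MatA 2 := ((avgFun expMeanLogSU (pert F k K Vk x') c : SU 2) : MatA 2)
  set B : MatA 2 := ((avgFun expMeanLogSU Vk c : SU 2) : MatA 2)
  set ut : MatA 2 := ((u (emb c.tgt) : SU 2) : MatA 2) with hut
  have hprod : uc * A * star ut * star (uc * B * star ut) = uc * (A * star B) * star uc := by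
    rw [star_mul, star_mul, star_star]
    calc uc * A * star ut * (ut * (star B * star uc)) = uc * A * (star ut * ut) * star B * star uc := by noncomm_ring
      _ = uc * (A * star B) * star uc := by rw [hut, star_mul_coe_self_SU, mul_one]; noncomm_ring
  rw [hprod]
  exact B7Prop6Flat.mlog_conj w (A * star B)

/-- **The rotated coordinates exist as a continuous linear map**: `x ↦ (su2Coord (u(b₋)* · B′(b) · u(b₋)))_{(b,a)}`, with `fluctMat (R x) b = u(b₋)* B′(b) u(b₋)` (conjugates of 𝔰𝔲(2) by
unitaries stay in 𝔰𝔲(2); `sum_su2Coord_smul_su2Gen`). [cite: Balaban1987RG1, (2.16) p.269 (bookkeeping)] -/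
theorem exists_rotCLM (k K : ℕ) (u : GaugeTransf (F.P K) k (SU 2)) :
    ∃ R : (FluctIdx F k K → ℝ) →L[ℝ] (FluctIdx F k K → ℝ),
      ∀ (x : FluctIdx F k K → ℝ) (b : PBond (F.P K) k), fluctMat F k K (R x) b = star ((u b.src : SU 2) : MatA 2) * fluctMat F k K x b * ((u b.src : SU 2) : MatA 2) := by
  let Rlin : (FluctIdx F k K → ℝ) →ₗ[ℝ] (FluctIdx F k K → ℝ) :=
    { toFun := fun x i => su2Coord (star ((u i.1.src : SU 2) : MatA 2) * fluctMat F k K x i.1 * ((u i.1.src : SU 2) : MatA 2)) i.2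
      map_add' := fun x y => by
        funext i
        obtain ⟨b, a⟩ := i
        simp only [Pi.add_apply, fluctMat_add, mul_add, add_mul]
        fin_cases a <;> simp [su2Coord]
      map_smul' := fun t x => by
        funext i
        obtain ⟨b, a⟩ := i
        simp only [Pi.smul_apply, fluctMat_smul, RingHom.id_apply, mul_smul_comm, smul_mul_assoc, smul_eq_mul]
        fin_cases a <;> simp [su2Coord] }
  refine ⟨LinearMap.toContinuousLinearMap Rlin, fun x b => ?_⟩
  have hmem : star ((u b.src : SU 2) : MatA 2) * fluctMat F k K x b * ((u b.src : SU 2) : MatA 2) ∈ lieSU (Fin 2) := by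
    have h := conj_mem_lieSU (fluctMat_mem_lieSU F k K x b) ⟨star ((u b.src : SU 2) : MatA 2), Unitary.star_mem (Matrix.mem_specialUnitaryGroup_iff.mp (u b.src).2).1⟩
    simpa only [star_star] using h
  show fluctMat F k K (fun i => su2Coord (star ((u i.1.src : SU 2) : MatA 2) * fluctMat F k K x i.1 * ((u i.1.src : SU 2) : MatA 2)) i.2) b = _
  rw [fluctMat]
  exact sum_su2Coord_smul_su2Gen hmem

/-- ★★ **`LQ̃` IS GAUGE COVARIANT at small backgrounds**: `(LQ̃(V^{(k),u}) x)(c) = u(c₋)·(LQ̃(V^{(k)}) (R x))(c)·u(c₋)*` for the coordinate rotation `R` (`Q̃(V^u, ·) = Ad_{u(c₋)} ∘ Q̃(V, ·) ∘ R`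
for ALL fluctuations; chain rule at `0`, `Q̃(V, ·)` differentiable there by ✓p811778). [cite: Balaban1987RG1, (2.16) p.269, p.267] -/
theorem recordLQt_gaugeAct (k K : ℕ) (hk : k + 1 ≤ (F.P K).m + (F.P K).K) (u : GaugeTransf (F.P K) k (SU 2)) (Vk : GaugeField (F.P K) k (SU 2))
    (hs : ∀ c : PBond (F.P K) (k + 1), Small expMeanLogSU Vk c) (R : (FluctIdx F k K → ℝ) →L[ℝ] (FluctIdx F k K → ℝ))
    (hR : ∀ (x : FluctIdx F k K → ℝ) (b : PBond (F.P K) k), fluctMat F k K (R x) b = star ((u b.src : SU 2) : MatA 2) * fluctMat F k K x b * ((u b.src : SU 2) : MatA 2))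
    (x : FluctIdx F k K → ℝ) (c : PBond (F.P K) (k + 1)) :
    recordLQt F k K (GaugeField.gaugeAct u Vk) x c =
      ((u (emb c.src) : SU 2) : MatA 2) * recordLQt F k K Vk (R x) c * star ((u (emb c.src) : SU 2) : MatA 2) := by
  set uc : MatA 2 := ((u (emb c.src) : SU 2) : MatA 2) with huc
  -- `Q̃(V^u, ·)(c) = Ad_{u(c₋)} ∘ Q̃(V, ·)(c) ∘ R`
  have hfun : (fun y => recordQt F k K (GaugeField.gaugeAct u Vk) y c) = fun y => uc * recordQt F k K Vk (R y) c * star uc :=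
    funext fun y => recordQt_gaugeAct F k K hk u Vk y (R y) (fun b => hR y b) c
  -- the conjugation as a continuous linear map
  let Ad : MatA 2 →L[ℝ] MatA 2 := ((ContinuousLinearMap.mul ℝ (MatA 2) uc).comp ((ContinuousLinearMap.mul ℝ (MatA 2)).flip (star uc)))
  have hAd : ∀ M : MatA 2, Ad M = uc * M * star uc := fun M => by
    show uc * (M * star uc) = uc * M * star uc
    rw [mul_assoc]
  -- derivative of the right-hand side at `0`
  have hQ : HasFDerivAt (recordQt F k K Vk) (recordLQt F k K Vk) (R 0) := by
    rw [map_zero]; exact hasFDerivAt_recordQt_of_small F k K hk Vk hs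
  have hQc : HasFDerivAt (fun y => recordQt F k K Vk y c) ((ContinuousLinearMap.proj c).comp (recordLQt F k K Vk)) (R 0) :=
    (hasFDerivAt_pi'.mp hQ) c
  have hcomp : HasFDerivAt (fun y => recordQt F k K Vk (R y) c) (((ContinuousLinearMap.proj c).comp (recordLQt F k K Vk)).comp R) 0 :=
    hQc.comp (0 : FluctIdx F k K → ℝ) R.hasFDerivAt
  have hfull : HasFDerivAt (fun y => uc * recordQt F k K Vk (R y) c * star uc) (Ad.comp ((((ContinuousLinearMap.proj c).comp (recordLQt F k K Vk)).comp R))) 0 := by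
    have h := Ad.hasFDerivAt.comp (0 : FluctIdx F k K → ℝ) hcomp
    refine h.congr_of_eventuallyEq (Eventually.of_forall fun y => ?_)
    simp only [Function.comp_apply, hAd]
  -- derivative of the left-hand side at `0`
  have hs_u : ∀ c' : PBond (F.P K) (k + 1), Small expMeanLogSU (GaugeField.gaugeAct u Vk) c' := fun c' => (small_gaugeAct_iff expMeanLogSU u Vk c').mpr (hs c')
  have hL : HasFDerivAt (fun y => recordQt F k K (GaugeField.gaugeAct u Vk) y c) ((ContinuousLinearMap.proj c).comp (recordLQt F k K (GaugeField.gaugeAct u Vk))) 0 :=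
    (hasFDerivAt_pi'.mp (hasFDerivAt_recordQt_of_small F k K hk _ hs_u)) c
  rw [hfun] at hL
  have heq := hL.unique hfull
  have h1 := congrArg (fun T : (FluctIdx F k K → ℝ) →L[ℝ] MatA 2 => T x) heq
  simpa only [ContinuousLinearMap.coe_comp, Function.comp_apply, ContinuousLinearMap.proj_apply, hAd] using h1

end Summit.QuantumFields.YangMills.Theorems.BalabanUVNodesPortS1

end
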